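import Summits.HodgeConjecture.CorCM.SimpleCMDistinctClosuresPairwise
import Summits.HodgeConjecture.CorCM.PairwiseCMFamiliesHodge
import HarnessLib

/-!
# Products of ANY NUMBER of simple CM abelian varieties of dimension `≤ 3` whose CM fields have pairwise distinct Galois
# closures: `Hg(∏ A_i) = ∏ Hg(A_i)` and the Hodge conjecture on every `∏ A_i^{k_i}` iff no imaginary quadratic field
# embeds in two of the fields

COR-CM (cell `pub-hodgecm2`, binder seat `b16` gen 43, count-neutral claim CM-DIMLE3-PRODUCTS, file F5; theorems only, no
definition, no named fact, no `sorry`).  NEW as stated, hence under `Summits/`.  HONEST FRAMING: an unconditional theorem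
on products of CM abelian varieties of small dimension; not a step of the summit chain (HC_CM is not used and not
advanced).

THE THEOREM.  Let `A_i` (`i ∈ I`, finite) be SIMPLE complex abelian varieties of CM type of dimension `≤ 3` — CM elliptic
curves, simple CM surfaces, simple CM threefolds, in any number and combination — realising CM types `Φ_i` of CM fields
`K_i` (`[K_i : ℚ] = 2 dim A_i`), and suppose the Galois closures `L_i ≤ ℂ` of the `K_i` are PAIRWISE DISTINCT.  Then

* `isNondegenerateFamily_simple_dim_le_three_iff_of_normalClosure_ne` — **the family `(Φ_i)_i` is nondegenerate
  (`Hg(∏_i A_i) = ∏_i Hg(A_i)` of rank `Σ_i dim A_i`; equivalently `B• = D•` on every `∏_i A_i^{k_i}`) IF AND ONLY IF no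
  imaginary quadratic field embeds in two of the `K_i`** (no `F ≤ K_i`, `[F : ℚ] = 2`, `F` totally complex, with
  `Hom(F, K_j) ≠ ∅`, `i ≠ j`);
* `hodgeConjectureFor_prod_simple_dim_le_three_of_normalClosure_ne` — hence **the Hodge conjecture, with all Hodge classes
  polynomials in divisor classes (`hodgeClassSpan_prod_eq_simple_dim_le_three_of_normalClosure_ne`), on EVERY product
  `⨁_{j<N} A_{π j}` as soon as no imaginary quadratic field is shared** — UNCONDITIONALLY;
* `exists_exceptional_prod_simple_dim_le_three_iff_of_normalClosure_ne` — and conversely (pairwise non-isogenous `A_i`)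
  an exceptional Hodge class on some power product iff two of the fields DO share an imaginary quadratic field;
* `cmFamilyRank_simple_dim_le_three_of_normalClosure_ne` — `rank Hg(∏_i A_i) + |I| = Σ_i rank(Φ_i) + 1` in every case.

PROOF.  The pairwise criterion (`PairwiseCMFamiliesHodge.isNondegenerateFamily_iff_forall_of_pairwise`, seat p2): it
suffices that for all `i ≠ j` the `Aut(ℂ)`-modules `U(Φ_i)`, `U(Φ_j)` have no common constituent, which for two simple CM
abelian varieties of dimension `≤ 3` with different Galois closures and no shared imaginary quadratic field is the pair kit
`pairwise_simple_dim_le_three_of_normalClosure_ne` (`CorCM/SimpleCMDistinctClosuresPairwise`: criteria (κ), (λ), (α) and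
foreign quadratic slots, by kind); every member is nondegenerate (Ribet: simple of dimension `≤ 3`).  Necessity of the
criterion is uniform (seat b23's `not_isNondegenerateFamily_of_shared_imaginary_quadratic`).

SCOPE.  "Pairwise distinct Galois closures" excludes exactly the configurations where pairs do NOT propagate to products:
several isogeny classes with one sextic field (four of them are degenerate, seat p2), a non-Galois quartic CM field with its
reflex field (three such surfaces are degenerate, seat p2), twin sextic fields `k·F`, `k′·F` in one closure.  Those blocks
are the subject of the sequel; the pair census (`CorCM/SimpleCMPairsDimLeThreeHodge`) is the case `|I| = 2` without the
closure hypothesis.  HC_CM is NOT proved and not touched.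

## References

* [MoonenZarhin1999LowDim] B. Moonen, Yu. Zarhin, *Hodge classes on abelian varieties of low dimension*, Math. Ann. 315
  (1999), Thm. (0.2), §3 (3.1), (3.9).
* [Gordon1999HodgeAVSurvey] B. B. Gordon, *A survey of the Hodge conjecture for abelian varieties*, §3 Theorem (Imai,
  Murty), 7.4–7.7, 9.4, 10.10.
* [Shimura1998] G. Shimura, *Abelian Varieties with Complex Multiplication and Modular Functions*, §8.2 Prop. 26, §8.4.
* [Deligne1982HodgeCycles] P. Deligne, *Hodge cycles on abelian varieties*, LNM 900 (1982), I Ex. 3.7.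
-/

noncomputable section

open CategoryTheory CategoryTheory.Limits NumberField Module IntermediateField

namespace Summit.HodgeConjecture.CorCM

open Literature.NumberTheory.ComplexMultiplication
open Literature.AlgebraicGeometry.Motives (AbelianVariety CMType)
open Literature.AlgebraicGeometry.HodgeTheory
open Literature.AlgebraicGeometry.ComplexMultiplication (IsCMTypeRealisation isSimple_iff_isPrimitive)
open Literature.AlgebraicGeometry.VanGeemen1994 (hodgeClassSpan)
open Literature.AlgebraicGeometry.Pohlmann1968
open Literature.Barriers.HodgeConjecture (divisorClassesSpan)

variable {I : Type} {K : I → Type} [∀ i, Field (K i)] [∀ i, NumberField (K i)] [∀ i, IsCMField (K i)] [Fintype I]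
  [DecidableEq I] [Nonempty I] {Φ : ∀ i, CMType (K i)}
variable {A : I → AbelianVariety ℂ} {ι : ∀ i, 𝓞 (K i) →+* End (A i)}
  {θ : ∀ i, K i →+* Module.End ℂ (complexBetti (A i).X 1)}

omit [Fintype I] [DecidableEq I] [Nonempty I] in
/-- **No two slots share a constituent** for simple CM abelian varieties of dimension `≤ 3` with pairwise distinct Galois
closures and no shared imaginary quadratic field (the pair kit, slot by slot). [cite: MoonenZarhin1999LowDim, Thm. (0.2) and (3.9)] -/
theorem pairwise_simple_dim_le_three_of_forall_normalClosure_ne (hA : ∀ i, IsCMTypeRealisation (Φ i) (A i) (ι i) (θ i))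
    (hS : ∀ i, (A i).IsSimple) (h3 : ∀ i, (A i).dim ≤ 3)
    (hL : ∀ i j, i ≠ j → normalClosure ℚ (K i) ℂ ≠ normalClosure ℚ (K j) ℂ)
    (hno : ∀ i j, i ≠ j →
      ¬ ∃ F : IntermediateField ℚ (K i), finrank ℚ F = 2 ∧ IsTotallyComplex F ∧ Nonempty (F →+* K j)) :
    ∀ i j, i ≠ j → ∀ P : Submodule ℚ ((K i →+* ℂ) → ℚ), P ≤ antiSpan (ℂ ≃+* ℂ) (Φ i).1 →
      (∀ g : ℂ ≃+* ℂ, ∀ f ∈ P, (fun x => f (g • x)) ∈ P) →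
      ∀ T : ((K i →+* ℂ) → ℚ) →ₗ[ℚ] ((K j →+* ℂ) → ℚ),
        (∀ g : ℂ ≃+* ℂ, ∀ f ∈ P, T (fun x => f (g • x)) = fun y => T f (g • y)) →
        (∀ f ∈ P, T f ∈ antiSpan (ℂ ≃+* ℂ) (Φ j).1) → (∀ f ∈ P, T f = 0 → f = 0) → P = ⊥ :=
  fun i j hij => (pairwise_simple_dim_le_three_of_normalClosure_ne hA hS h3 (hL i j hij) (hno i j hij)
    (hno j i hij.symm)).1

/-- **Products of simple CM abelian varieties of dimension `≤ 3` with pairwise distinct Galois closures, types level**: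
the family `(Φ_i)_i` of their CM types is nondegenerate — `Hg(∏_i A_i) = ∏_i Hg(A_i)`, stably nondegenerate product — IF
AND ONLY IF no totally complex quadratic subfield of one `K_i` embeds in another `K_j`.
[cite: MoonenZarhin1999LowDim, Thm. (0.2) and (3.9)] [cite: Gordon1999HodgeAVSurvey, §3 Theorem, 7.5 and 9.4] -/
theorem isNondegenerateFamily_simple_dim_le_three_iff_of_normalClosure_ne
    (hA : ∀ i, IsCMTypeRealisation (Φ i) (A i) (ι i) (θ i)) (hS : ∀ i, (A i).IsSimple) (h3 : ∀ i, (A i).dim ≤ 3)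
    (hL : ∀ i j, i ≠ j → normalClosure ℚ (K i) ℂ ≠ normalClosure ℚ (K j) ℂ) :
    CMAlgebra.IsNondegenerateFamily Φ ↔ ∀ i j, i ≠ j →
      ¬ ∃ F : IntermediateField ℚ (K i), finrank ℚ F = 2 ∧ IsTotallyComplex F ∧ Nonempty (F →+* K j) := by
  constructor
  · rintro hnd i j hij ⟨F, hF2, hFtc, ⟨g⟩⟩
    haveI := hFtc
    exact not_isNondegenerateFamily_of_shared_imaginary_quadratic (k := ↥F) hF2 hij (algebraMap (↥F) (K i)) g Φ hnd
  · intro hno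
    exact (isNondegenerateFamily_iff_forall_of_pairwise Φ
      (pairwise_simple_dim_le_three_of_forall_normalClosure_ne hA hS h3 hL hno)).2
      fun i => isNondegenerate_of_isSimple_of_dim_le_three_slot hA (hS i) (h3 i)

/-- **The rank of the Hodge group**: for simple CM abelian varieties of dimension `≤ 3` with pairwise distinct Galois
closures and no shared imaginary quadratic field, `rank((Φ_i)_i) + |I| = Σ_i rank(Φ_i) + 1` — `rank Hg(∏_i A_i) =
Σ_i rank Hg(A_i) = Σ_i dim A_i`. [cite: MoonenZarhin1999LowDim, (3.1)] [cite: Gordon1999HodgeAVSurvey, §3 Theorem (1)] -/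
theorem cmFamilyRank_simple_dim_le_three_of_normalClosure_ne (hA : ∀ i, IsCMTypeRealisation (Φ i) (A i) (ι i) (θ i))
    (hS : ∀ i, (A i).IsSimple) (h3 : ∀ i, (A i).dim ≤ 3)
    (hL : ∀ i j, i ≠ j → normalClosure ℚ (K i) ℂ ≠ normalClosure ℚ (K j) ℂ)
    (hno : ∀ i j, i ≠ j →
      ¬ ∃ F : IntermediateField ℚ (K i), finrank ℚ F = 2 ∧ IsTotallyComplex F ∧ Nonempty (F →+* K j)) :
    CMAlgebra.cmFamilyRank Φ + Fintype.card I = (∑ i, cmTypeRank (Φ i)) + 1 :=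
  cmFamilyRank_add_card_eq_of_pairwise Φ (pairwise_simple_dim_le_three_of_forall_normalClosure_ne hA hS h3 hL hno)

/-- **The Hodge conjecture on every product `⨁_{j<N} A_{π j}`** (every `∏_i A_i^{k_i}`) of simple CM abelian varieties of
dimension `≤ 3` whose CM fields have pairwise distinct Galois closures and share no imaginary quadratic field —
UNCONDITIONALLY. [cite: MoonenZarhin1999LowDim, Thm. (0.2) and (3.9)] [cite: Gordon1999HodgeAVSurvey, 7.5 and 10.10] -/
theorem hodgeConjectureFor_prod_simple_dim_le_three_of_normalClosure_ne
    (hA : ∀ i, IsCMTypeRealisation (Φ i) (A i) (ι i) (θ i)) (hS : ∀ i, (A i).IsSimple) (h3 : ∀ i, (A i).dim ≤ 3)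
    (hL : ∀ i j, i ≠ j → normalClosure ℚ (K i) ℂ ≠ normalClosure ℚ (K j) ℂ)
    (hno : ∀ i j, i ≠ j →
      ¬ ∃ F : IntermediateField ℚ (K i), finrank ℚ F = 2 ∧ IsTotallyComplex F ∧ Nonempty (F →+* K j))
    {N : ℕ} (π : Fin N → I) : HodgeConjectureFor (⨁ fun j : Fin N => A (π j)).dim (⨁ fun j : Fin N => A (π j)).X :=
  ((isNondegenerateFamily_simple_dim_le_three_iff_of_normalClosure_ne hA hS h3 hL).2 hno).hodgeConjectureFor_prod hA π

/-- **`B• = D•` on every product**: under the same hypotheses every Hodge class on `⨁_{j<N} A_{π j}` is a polynomial in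
divisor classes (`Bᵐ ⊗ ℂ = Dᵐ ⊗ ℂ` for all `m`). [cite: Gordon1999HodgeAVSurvey, 7.5 (1)] [cite: MoonenZarhin1999LowDim, (3.9)] -/
theorem hodgeClassSpan_prod_eq_simple_dim_le_three_of_normalClosure_ne
    (hA : ∀ i, IsCMTypeRealisation (Φ i) (A i) (ι i) (θ i)) (hS : ∀ i, (A i).IsSimple) (h3 : ∀ i, (A i).dim ≤ 3)
    (hL : ∀ i j, i ≠ j → normalClosure ℚ (K i) ℂ ≠ normalClosure ℚ (K j) ℂ)
    (hno : ∀ i j, i ≠ j →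
      ¬ ∃ F : IntermediateField ℚ (K i), finrank ℚ F = 2 ∧ IsTotallyComplex F ∧ Nonempty (F →+* K j))
    {N : ℕ} (π : Fin N → I) (m : ℕ) :
    hodgeClassSpan (⨁ fun j : Fin N => A (π j)).dim (⨁ fun j : Fin N => A (π j)).X m =
      divisorClassesSpan (⨁ fun j : Fin N => A (π j)).X (⨁ fun j : Fin N => A (π j)).dim m :=
  ((isNondegenerateFamily_simple_dim_le_three_iff_of_normalClosure_ne hA hS h3 hL).2 hno).hodgeClassSpan_prod_eq_divisorClassesSpan
    hA π m

/-- **`B• = D•` on ALL products iff no shared imaginary quadratic field** (pairwise non-isogenous simple factors of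
dimension `≤ 3`, pairwise distinct Galois closures): Hazama–Murty's stable nondegeneracy, decided by the fields.
[cite: Gordon1999HodgeAVSurvey, 7.5] [cite: MoonenZarhin1999LowDim, Thm. (0.2)] -/
theorem forall_prod_hodgeClassSpan_eq_simple_dim_le_three_iff_of_normalClosure_ne
    (hA : ∀ i, IsCMTypeRealisation (Φ i) (A i) (ι i) (θ i)) (hS : ∀ i, (A i).IsSimple)
    (hniso : ∀ i j, i ≠ j → ¬ AbelianVariety.IsIsogenous (A i) (A j)) (h3 : ∀ i, (A i).dim ≤ 3)
    (hL : ∀ i j, i ≠ j → normalClosure ℚ (K i) ℂ ≠ normalClosure ℚ (K j) ℂ) :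
    (∀ (N : ℕ) (π : Fin N → I) (m : ℕ),
      hodgeClassSpan (⨁ fun j : Fin N => A (π j)).dim (⨁ fun j : Fin N => A (π j)).X m =
        divisorClassesSpan (⨁ fun j : Fin N => A (π j)).X (⨁ fun j : Fin N => A (π j)).dim m) ↔
    ∀ i j, i ≠ j →
      ¬ ∃ F : IntermediateField ℚ (K i), finrank ℚ F = 2 ∧ IsTotallyComplex F ∧ Nonempty (F →+* K j) := by
  rw [← CMAlgebra.isNondegenerateFamily_iff_forall_prod_hodgeClassSpan_eq
    (CMAlgebra.isSeparatingFamily_of_isSimple_of_pairwise_not_isIsogenous hA hS hniso) hA]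
  exact isNondegenerateFamily_simple_dim_le_three_iff_of_normalClosure_ne hA hS h3 hL

/-- **An exceptional Hodge class on some power product iff two of the fields share an imaginary quadratic field**
(pairwise non-isogenous simple CM factors of dimension `≤ 3`, pairwise distinct Galois closures): a rational
`(m,m)`-class outside `Dᵐ ⊗ ℂ` on some `⨁_{j<N} A_{π j}` exists iff some `F ≤ K_i`, `[F:ℚ] = 2`, totally complex, embeds
in some `K_j`, `j ≠ i` — Weil-type classes are the ONLY exceptional classes here.
[cite: Gordon1999HodgeAVSurvey, 7.5 and 9.4] [cite: MoonenZarhin1999LowDim, Thm. (0.2)] -/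
theorem exists_exceptional_prod_simple_dim_le_three_iff_of_normalClosure_ne
    (hA : ∀ i, IsCMTypeRealisation (Φ i) (A i) (ι i) (θ i)) (hS : ∀ i, (A i).IsSimple)
    (hniso : ∀ i j, i ≠ j → ¬ AbelianVariety.IsIsogenous (A i) (A j)) (h3 : ∀ i, (A i).dim ≤ 3)
    (hL : ∀ i j, i ≠ j → normalClosure ℚ (K i) ℂ ≠ normalClosure ℚ (K j) ℂ) :
    (∃ (N : ℕ) (π : Fin N → I) (m : ℕ) (c : complexBetti (⨁ fun j : Fin N => A (π j)).X (2 * m)),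
      IsRationalClass c ∧
      IsOfHodgeType (⨁ fun j : Fin N => A (π j)).dim (⨁ fun j : Fin N => A (π j)).X (2 * m) m m c ∧
      c ∉ divisorClassesSpan (⨁ fun j : Fin N => A (π j)).X (⨁ fun j : Fin N => A (π j)).dim m) ↔
    ∃ i j, i ≠ j ∧
      ∃ F : IntermediateField ℚ (K i), finrank ℚ F = 2 ∧ IsTotallyComplex F ∧ Nonempty (F →+* K j) := by
  have key := isNondegenerateFamily_simple_dim_le_three_iff_of_normalClosure_ne (Φ := Φ) hA hS h3 hL
  constructor
  · rintro ⟨N, π, m, c, hcQ, hcH, hcD⟩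
    by_contra hne
    push Not at hne
    have hnd : CMAlgebra.IsNondegenerateFamily Φ := key.2 fun i j hij hex => by
      obtain ⟨F, hF2, hFtc, ⟨g⟩⟩ := hex
      exact (hne i j hij F hF2 hFtc).false g
    exact hnd.not_exists_exceptional_prod hA π m ⟨c, hcQ, hcH, hcD⟩
  · rintro ⟨i, j, hij, hF⟩
    have hnd : ¬ CMAlgebra.IsNondegenerateFamily Φ := fun h => key.1 h i j hij hF
    exact CMAlgebra.exists_exceptional_prod_of_not_isNondegenerateFamily
      (CMAlgebra.isSeparatingFamily_of_isSimple_of_pairwise_not_isIsogenous hA hS hniso) hnd hA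

/-- **Dichotomy**: for pairwise non-isogenous simple CM abelian varieties of dimension `≤ 3` with pairwise distinct Galois
closures, EITHER the Hodge conjecture holds with `B• = D•` on every power product, OR two of the CM fields share an
imaginary quadratic field and some power product carries an exceptional Hodge class.
[cite: Gordon1999HodgeAVSurvey, 7.5 and 10.10] [cite: MoonenZarhin1999LowDim, Thm. (0.2)] -/
theorem hodgeConjectureFor_prod_or_exists_exceptional_simple_dim_le_three_of_normalClosure_ne
    (hA : ∀ i, IsCMTypeRealisation (Φ i) (A i) (ι i) (θ i)) (hS : ∀ i, (A i).IsSimple)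
    (hniso : ∀ i j, i ≠ j → ¬ AbelianVariety.IsIsogenous (A i) (A j)) (h3 : ∀ i, (A i).dim ≤ 3)
    (hL : ∀ i j, i ≠ j → normalClosure ℚ (K i) ℂ ≠ normalClosure ℚ (K j) ℂ) :
    (∀ (N : ℕ) (π : Fin N → I), HodgeConjectureFor (⨁ fun j : Fin N => A (π j)).dim (⨁ fun j : Fin N => A (π j)).X) ∨
    ((∃ i j, i ≠ j ∧
        ∃ F : IntermediateField ℚ (K i), finrank ℚ F = 2 ∧ IsTotallyComplex F ∧ Nonempty (F →+* K j)) ∧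
      ∃ (N : ℕ) (π : Fin N → I) (m : ℕ) (c : complexBetti (⨁ fun j : Fin N => A (π j)).X (2 * m)),
        IsRationalClass c ∧
        IsOfHodgeType (⨁ fun j : Fin N => A (π j)).dim (⨁ fun j : Fin N => A (π j)).X (2 * m) m m c ∧
        c ∉ divisorClassesSpan (⨁ fun j : Fin N => A (π j)).X (⨁ fun j : Fin N => A (π j)).dim m) := by
  by_cases hno : ∀ i j, i ≠ j →
      ¬ ∃ F : IntermediateField ℚ (K i), finrank ℚ F = 2 ∧ IsTotallyComplex F ∧ Nonempty (F →+* K j)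
  · exact Or.inl fun N π => hodgeConjectureFor_prod_simple_dim_le_three_of_normalClosure_ne hA hS h3 hL hno π
  · right
    push Not at hno
    obtain ⟨i, j, hij, hF⟩ := hno
    exact ⟨⟨i, j, hij, hF⟩,
      (exists_exceptional_prod_simple_dim_le_three_iff_of_normalClosure_ne hA hS hniso h3 hL).2 ⟨i, j, hij, hF⟩⟩

end Summit.HodgeConjecture.CorCM

end
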